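import Literature.AnabelianGeometry.EtaleTheta.SettingModelChiBarKerHuu
import Literature.AnabelianGeometry.EtaleTheta.SettingModelTateDoubleUnderline
import Literature.AnabelianGeometry.EtaleTheta.SettingModelTateDeltaTheta
import HarnessLib

/-!
# GAP row G-L2d3-7 «Π^tp_{X̲̲} ⊇ Ker(Δ^tp_X ↠ Δ̄_X)» HOLDS at the STAGE-2 model: `barKerTp l ≤ Huuχq p i j l hl`
# (proof-only NV, second constructor site)

Mochizuki, *The étale theta function …*, Publ. RIMS **45** (2009) [EtTh], Prop. 2.2 (ii) p. 37, Def. 2.1 p. 35, Def. 2.5 (i)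
p. 39 [cite: MochizukiEtTh2009, Prop 2.2 (ii) p.37].  abc-iut cell, layer L2, prover abc-iut-L2-d1 (gen 5); PROOF-ONLY stage-2
twin of this seat's `SettingModelChiBarKerHuu` (abc-iut-L2-d3's binder `hK : M.barKerTp l ≤ C.Huu`, GAP G-L2d3-7) at the
constructor site `X̲̲ := Huuχq p i j l hl = dUU l ⋊ G_{ℚ_p}` of abc-iut-L2-t5's `modelχq p i j hj`: same route — the
normal form `exists_pow_mul_of_mem_powTheta` of `⟨l-th powers⟩`, the exponent law `pow_mem_dUU_of_odd` (`γ^l ∈ dUU l`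
for every `γ ∈ Γ`, odd `l`), this seat's `map_toTheta_Huuχq_modelχq` (`l·Δ_Θ = θ(Π^tp_X̲̲) ∩ Δ_Θ`) and `Ker θ ≤ Π^tp_X̲̲`.
SEMI-SYNTHETIC MODEL, consistency evidence only; nothing of [EtTh] asserted; no side taken on [IUTchIII] Cor. 3.12.
-/

noncomputable section

namespace Literature.AnabelianGeometry.EtaleTheta.SettingModel

open Literature.AnabelianGeometry.SemiGraphs _root_.Function

variable (p : ℕ) [Fact p.Prime] (i j : ℤ) {hj : Even j} (l : ℕ+) (hl : Odd (l : ℕ))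

/-- `Ker(Π^tp_X ↠ (Π^tp_X)^Θ) ≤ Π^tp_X̲̲` at the stage-2 model (level-trivial elements).
[cite: MochizukiEtTh2009, Def 2.5 (i) p.39] -/
theorem thetaKer_le_Huuχq : CurveTheta.thetaKer (curveχq p i j) ≤ Huuχq p i j l hl := fun x hx => by
  obtain ⟨hlev, -⟩ := (mem_thetaKerχq_iff p i j x).mp hx
  rw [mem_Huuχq_iff]
  have h1 : levelHom l x.left = 1 := hlev l
  rw [h1]
  exact ⟨rfl, rfl⟩

variable (hj)

/-- **GAP row G-L2d3-7 at the stage-2 model: `Ker(Δ^tp_X ↠ Δ̄_X) ≤ Π^tp_X̲̲ = Huuχq`** (odd `l`, even `j`).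
[cite: MochizukiEtTh2009, Prop 2.2 (ii) p.37] -/
theorem barKerTp_le_Huuχq : (ThetaSetting.modelχq p i j hj).barKerTp l ≤ Huuχq p i j l hl := by
  intro g hg
  obtain ⟨hgΔ, hgpow⟩ := (ThetaSetting.mem_barKerTp_iff (D := ThetaSetting.modelχq p i j hj) (l := (l : ℕ))).mp hg
  obtain ⟨t, ht, z, hz, hq⟩ :=
    ThetaSetting.exists_pow_mul_of_mem_powTheta (D := ThetaSetting.modelχq p i j hj) (l : ℕ) hl hgpow
  obtain ⟨g₀, hg₀, rfl⟩ := ht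
  have hr₀ : g₀.right = 1 := (mem_deltaTempχq_iff p i j g₀).mp hg₀
  have hg₀' : g₀ = SemidirectProduct.inl g₀.left := by
    rw [← SemidirectProduct.inl_left_mul_inr_right g₀, hr₀, map_one, mul_one]
    rfl
  have hz' : z ∈ (Huuχq p i j l hl).map (ThetaSetting.modelχq p i j hj).toTheta ⊓
      (ThetaSetting.modelχq p i j hj).DeltaTheta := by
    rw [map_toTheta_Huuχq_modelχq]
    exact hz
  obtain ⟨h, hh, rfl⟩ := (Subgroup.mem_inf.mp hz').1
  have hw : g₀ ^ (l : ℕ) * h ∈ Huuχq p i j l hl := by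
    refine mul_mem ?_ hh
    rw [hg₀', ← map_pow, inl_mem_Huuχq_iff]
    exact pow_mem_dUU_of_odd l hl _
  have hq' : CurveTheta.toTheta (curveχq p i j) g = CurveTheta.toTheta (curveχq p i j) (g₀ ^ (l : ℕ) * h) := by
    rw [map_mul, map_pow]
    exact hq
  rw [CurveTheta.toTheta, QuotientGroup.mk'_apply, QuotientGroup.mk'_apply, QuotientGroup.eq_iff_div_mem] at hq'
  rw [← div_mul_cancel g (g₀ ^ (l : ℕ) * h)]
  exact mul_mem (thetaKer_le_Huuχq p i j l hl hq') hw

end Literature.AnabelianGeometry.EtaleTheta.SettingModel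

end
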